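import Literature.RepresentationTheory.BorelWallach2000.UpqHodgeBigrading        -- ★ `upqZ0`, blocks of `𝔨` and of `K`, `upqUnit`, `upq_fromBlocks_mem_lie_iff`
import Literature.RepresentationTheory.BorelWallach2000.UpqMaximalCompactBlocks  -- ★ `upq_K_blocks`, `upqKBlock₁∕₂`
import HarnessLib

/-!
# The complexified action `ρ_ℂ : 𝔤𝔩(α ⊕ β, ℂ) → End_ℂ V` of a `(𝔤, K)`-module of `U(α, β)`: root operators `E_B`, `F_C`

Topic `NumberTheory/Automorphic`; namespace `Literature.NumberTheory.Automorphic`.  DEFINITIONS with bodies (`upqTheta`, `upqRePart`, `upqImPart`,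
`upqLieC`, `upqEOp`, `upqFOp`) and theorems; no named fact, no instance, no notation, no `sorry`.  Cell `hodgecm-mathlib`, F0∕P3, T1a arch line, road «V19
in-house for `U(2,1)`» (★ `IrreducibleUnitaryKTypeGrowth`, [Varadarajan1989, §5.4 Thm. 19]): node N3a «root-operator calculus» (seat A-p14 (g23); LEAD F0P3b-p01
(g2)) — the `Sym(𝔭_ℂ) = Sym(𝔭⁺) ⊗ Sym(𝔭⁻)` vocabulary INSIDE a `(𝔤, K)`-module, needed to cut the graded pieces of the `𝔭`-filtration (★ `upqPFiltration`) into
`K`-types.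

THE MATHEMATICS ([Knapp2002, VI §2: real forms and complexification]; [KnappVogan1995, §IV.1]; [BorelWallach2000, II §4.1–4.2: `𝔭_ℂ = 𝔭⁺ ⊕ 𝔭⁻` for `𝔲(p,q)`]).
`𝔤 = 𝔲(α, β) = {X : Xᴴ D + D X = 0}` (`D = diag(1_α, −1_β)`, ★ `RealDualPair.signForm`) is a real form of `𝔤_ℂ = 𝔤𝔩(α ⊕ β, ℂ)`: the conjugate-linear involution
`θ(M) = −D Mᴴ D` (`upqTheta`) is an anti-automorphism up to sign (`θ(MN) = −θ(N) θ(M)`, hence a Lie automorphism `θ[M, N] = [θM, θN]`) with fixed points `𝔤`, and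
every `M` is `A(M) + i B(M)` with `A(M) = ½ (M + θM)`, `B(M) = ½ i (θM − M)` in `𝔤` (`upqRePart`, `upqImPart`).  A real Lie algebra action `ρ𝔤 : 𝔤 →ₗ⁅ℝ⁆ End_ℂ V`
therefore extends UNIQUELY to the complex Lie algebra homomorphism `ρ_ℂ(M) := ρ𝔤(A M) + i ρ𝔤(B M)` (`upqLieC`; `upqLieC_of_mem`: it extends `ρ𝔤`).  In block form,
`𝔭⁺ = [[0, B], [0, 0]]`, `𝔭⁻ = [[0, 0], [C, 0]]`, `𝔨_ℂ = [[D₁, 0], [0, D₂]]`, and `ρ_ℂ` gives the ROOT OPERATORS `E_B := ρ_ℂ [[0,B],[0,0]]` (`upqEOp`, `ℂ`-linear in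
`B`), `F_C := ρ_ℂ [[0,0],[C,0]]` (`upqFOp`) with: `ρ𝔤(X_B) = E_B + F_{Bᴴ}` for the hermitian generator `X_B = [[0,B],[Bᴴ,0]]` of `𝔭` (so `ρ𝔤(X_{cE_p}) = c E_p + c̄ F_p`);
`[E_B, E_{B'}] = 0`, `[F_C, F_{C'}] = 0` (`𝔭^±` abelian); `[E_B, F_C] = ρ_ℂ [[BC, 0], [0, −CB]] ∈ ρ_ℂ(𝔨_ℂ)`; `[ρ_ℂ [[D₁,0],[0,D₂]], E_B] = E_{D₁B − BD₂}`,
`[ρ_ℂ [[D₁,0],[0,D₂]], F_C] = F_{D₂C − CD₁}`; `[ρ𝔤(z₀), E_B] = i E_B`, `[ρ𝔤(z₀), F_C] = −i F_C` (★ `upqZ0 = [[i·1, 0],[0, 0]]`: the `ℤ`-GRADING by `z₀`); the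
`𝔨_ℂ`-operators preserve every `𝔨`-stable complex subspace; and `K`-CONJUGATION `ρK(k) ρ_ℂ(M) ρK(k)⁻¹ = ρ_ℂ(k M k⁻¹)` (★ `IsGKModule.ad_compat`), in particular
`ρK(k) E_B ρK(k)⁻¹ = E_{k₁ B k₂ᴴ}`, `ρK(k) F_C ρK(k)⁻¹ = F_{k₂ C k₁ᴴ}` for `k = diag(k₁, k₂) ∈ K = U(α) × U(β)`.

HONEST LABEL: kernel definitions∕theorems about abstract `(𝔤, K)`-modules of `U(α, β)`; nothing printed about HC_CM is discharged here.  HC_CM is proved only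
modulo the 2 remaining named inputs (hLiu418, h413) until rung 0 closes.

## References
* A. W. Knapp, *Lie Groups Beyond an Introduction*, 2nd ed. (2002), VI §2. [Knapp2002]
* A. W. Knapp, D. A. Vogan, *Cohomological Induction and Unitary Representations* (1995), §IV.1. [KnappVogan1995]
* A. Borel, N. Wallach, *Continuous Cohomology, Discrete Subgroups, and Representations of Reductive Groups*, 2nd ed. (2000), II §4.1–4.2. [BorelWallach2000]
-/

-- Mathlib idiom (as in ★ `GKModules` and every `(𝔤, K)` file of the tree): the commutator bracket on `Module.End ℂ V` and on matrices, needed to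
-- MENTION `ρ𝔤 : (uFormGroup α β).lie →ₗ⁅ℝ⁆ Module.End ℂ V` (`LieRing.ofAssociativeRing` is a `def` in Mathlib, not a global instance).
attribute [local instance 100] LieRing.ofAssociativeRing

set_option autoImplicit false

open scoped MatrixGroups Matrix ComplexConjugate

noncomputable section

namespace Literature.NumberTheory.Automorphic

open Literature.RepresentationTheory Literature.RepresentationTheory.BorelWallach2000 Literature.RepresentationTheory.KonnoKonno2007
open Literature.RepresentationTheory.KonnoKonno2007.RealDualPair (signForm)

variable {α β : Type} [Fintype α] [DecidableEq α] [Fintype β] [DecidableEq β]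

/-! ## §1 The Cartan involution `θ(M) = −D Mᴴ D` of `𝔤𝔩(α ⊕ β, ℂ)` with fixed points `𝔲(α, β)` -/

section Theta

/-- `D² = 1` for `D = diag(1_α, −1_β)`. [cite: Knapp2002, VI §2] -/
private theorem sF_mul_sF : signForm α β * signForm α β = 1 := signForm_mul_signForm α β

variable (α β) in
/-- **The involution `θ(M) = −D Mᴴ D`** of `𝔤𝔩(α ⊕ β, ℂ)` (`D = diag(1_α, −1_β)`), conjugate-linear, whose fixed points are `𝔲(α, β)`.
[cite: Knapp2002, VI §2] -/
def upqTheta (M : Matrix (α ⊕ β) (α ⊕ β) ℂ) : Matrix (α ⊕ β) (α ⊕ β) ℂ := -(signForm α β * Mᴴ * signForm α β)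

/-- Unfolding of `θ`. [cite: Knapp2002, VI §2] -/
theorem upqTheta_apply (M : Matrix (α ⊕ β) (α ⊕ β) ℂ) : upqTheta α β M = -(signForm α β * Mᴴ * signForm α β) := rfl

/-- `θ` is additive. [cite: Knapp2002, VI §2] -/
theorem upqTheta_add (M N : Matrix (α ⊕ β) (α ⊕ β) ℂ) : upqTheta α β (M + N) = upqTheta α β M + upqTheta α β N := by
  simp only [upqTheta, Matrix.conjTranspose_add, Matrix.mul_add, Matrix.add_mul, neg_add]

/-- `θ(−M) = −θ(M)`. [cite: Knapp2002, VI §2] -/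
theorem upqTheta_neg (M : Matrix (α ⊕ β) (α ⊕ β) ℂ) : upqTheta α β (-M) = -upqTheta α β M := by
  simp only [upqTheta, Matrix.conjTranspose_neg, Matrix.mul_neg, Matrix.neg_mul]

/-- `θ(M − N) = θ(M) − θ(N)`. [cite: Knapp2002, VI §2] -/
theorem upqTheta_sub (M N : Matrix (α ⊕ β) (α ⊕ β) ℂ) : upqTheta α β (M - N) = upqTheta α β M - upqTheta α β N := by
  rw [sub_eq_add_neg, upqTheta_add, upqTheta_neg, ← sub_eq_add_neg]

/-- `θ` is conjugate-linear: `θ(c M) = c̄ θ(M)`. [cite: Knapp2002, VI §2] -/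
theorem upqTheta_smul (c : ℂ) (M : Matrix (α ⊕ β) (α ⊕ β) ℂ) : upqTheta α β (c • M) = conj c • upqTheta α β M := by
  simp only [upqTheta, Matrix.conjTranspose_smul, Complex.star_def, Matrix.mul_smul, Matrix.smul_mul, smul_neg]

/-- `θ(0) = 0`. [cite: Knapp2002, VI §2] -/
@[simp] theorem upqTheta_zero : upqTheta α β (0 : Matrix (α ⊕ β) (α ⊕ β) ℂ) = 0 := by
  simp [upqTheta]

/-- `D X D · D Y D = D (X Y) D` (`D² = 1`). [cite: Knapp2002, VI §2] -/
private theorem sF_conj_mul_sF_conj (X Y : Matrix (α ⊕ β) (α ⊕ β) ℂ) :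
    signForm α β * X * signForm α β * (signForm α β * Y * signForm α β) = signForm α β * (X * Y) * signForm α β := by
  calc signForm α β * X * signForm α β * (signForm α β * Y * signForm α β)
        = signForm α β * X * (signForm α β * signForm α β) * Y * signForm α β := by simp only [Matrix.mul_assoc]
    _ = signForm α β * (X * Y) * signForm α β := by rw [sF_mul_sF, Matrix.mul_one]; simp only [Matrix.mul_assoc]

/-- `θ` is an involution. [cite: Knapp2002, VI §2] -/
theorem upqTheta_upqTheta (M : Matrix (α ⊕ β) (α ⊕ β) ℂ) : upqTheta α β (upqTheta α β M) = M := by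
  have h1 : (upqTheta α β M)ᴴ = -(signForm α β * M * signForm α β) := by
    rw [upqTheta_apply, Matrix.conjTranspose_neg, Matrix.conjTranspose_mul, Matrix.conjTranspose_mul, conjTranspose_signForm,
      Matrix.conjTranspose_conjTranspose, Matrix.mul_assoc]
  rw [upqTheta_apply, h1, Matrix.mul_neg, Matrix.neg_mul, neg_neg]
  calc signForm α β * (signForm α β * M * signForm α β) * signForm α β
        = (signForm α β * signForm α β) * M * (signForm α β * signForm α β) := by simp only [Matrix.mul_assoc]
    _ = M := by rw [sF_mul_sF, Matrix.one_mul, Matrix.mul_one]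

/-- `θ(M N) = −θ(N) θ(M)`. [cite: Knapp2002, VI §2] -/
theorem upqTheta_mul (M N : Matrix (α ⊕ β) (α ⊕ β) ℂ) : upqTheta α β (M * N) = -(upqTheta α β N * upqTheta α β M) := by
  rw [upqTheta, upqTheta, upqTheta, Matrix.conjTranspose_mul, neg_mul_neg, sF_conj_mul_sF_conj, ← Matrix.mul_assoc]

/-- **`θ` is a Lie algebra automorphism**: `θ[M, N] = [θM, θN]`. [cite: Knapp2002, VI §2] -/
theorem upqTheta_lie (M N : Matrix (α ⊕ β) (α ⊕ β) ℂ) : upqTheta α β ⁅M, N⁆ = ⁅upqTheta α β M, upqTheta α β N⁆ := by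
  rw [Ring.lie_def, Ring.lie_def, upqTheta_sub, upqTheta_mul, upqTheta_mul]
  abel

/-- **The fixed points of `θ` are `𝔲(α, β)`**: `X ∈ 𝔤 ↔ θX = X`. [cite: Knapp2002, VI §2] -/
theorem mem_uFormGroup_lie_iff_upqTheta_eq (X : Matrix (α ⊕ β) (α ⊕ β) ℂ) : X ∈ (uFormGroup α β).lie ↔ upqTheta α β X = X := by
  rw [mem_uFormGroup_lie_iff, upqTheta]
  constructor
  · intro h
    have h' : Xᴴ * signForm α β = -(signForm α β * X) := eq_neg_of_add_eq_zero_left h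
    rw [Matrix.mul_assoc, h', Matrix.mul_neg, ← Matrix.mul_assoc, sF_mul_sF, Matrix.one_mul, neg_neg]
  · intro h
    have h' : signForm α β * (-(signForm α β * Xᴴ * signForm α β)) = signForm α β * X := by rw [h]
    rw [Matrix.mul_neg, ← Matrix.mul_assoc, ← Matrix.mul_assoc, sF_mul_sF, Matrix.one_mul] at h'
    rw [← h', add_neg_cancel]

/-- `θ X = X` for `X ∈ 𝔲(α, β)`. [cite: Knapp2002, VI §2] -/
theorem upqTheta_of_mem (X : (uFormGroup α β).lie) : upqTheta α β (X : Matrix (α ⊕ β) (α ⊕ β) ℂ) = X :=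
  (mem_uFormGroup_lie_iff_upqTheta_eq _).1 X.2

end Theta

/-! ## §2 The real and imaginary parts `A(M) = ½(M + θM)`, `B(M) = ½ i (θM − M)` in `𝔲(α, β)` -/

section Parts

variable (α β) in
/-- **`A(M) = ½ (M + θM) ∈ 𝔲(α, β)`**, the `𝔲(α, β)`-part of `M ∈ 𝔤𝔩(α ⊕ β, ℂ)` (`M = A(M) + i B(M)`). [cite: Knapp2002, VI §2] -/
def upqRePart (M : Matrix (α ⊕ β) (α ⊕ β) ℂ) : (uFormGroup α β).lie :=
  ⟨(2⁻¹ : ℂ) • (M + upqTheta α β M), by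
    rw [mem_uFormGroup_lie_iff_upqTheta_eq, upqTheta_smul, upqTheta_add, upqTheta_upqTheta, map_inv₀, map_ofNat, add_comm]⟩

variable (α β) in
/-- **`B(M) = ½ i (θM − M) ∈ 𝔲(α, β)`**, so that `M = A(M) + i B(M)`. [cite: Knapp2002, VI §2] -/
def upqImPart (M : Matrix (α ⊕ β) (α ⊕ β) ℂ) : (uFormGroup α β).lie :=
  ⟨(2⁻¹ : ℂ) • (Complex.I • (upqTheta α β M - M)), by
    rw [mem_uFormGroup_lie_iff_upqTheta_eq, upqTheta_smul, upqTheta_smul, upqTheta_sub, upqTheta_upqTheta, map_inv₀, map_ofNat,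
      Complex.conj_I, neg_smul, ← smul_neg, neg_sub]⟩

/-- The matrix of `A(M)`. [cite: Knapp2002, VI §2] -/
@[simp] theorem coe_upqRePart (M : Matrix (α ⊕ β) (α ⊕ β) ℂ) :
    ((upqRePart α β M : (uFormGroup α β).lie) : Matrix (α ⊕ β) (α ⊕ β) ℂ) = (2⁻¹ : ℂ) • (M + upqTheta α β M) := rfl

/-- The matrix of `B(M)`. [cite: Knapp2002, VI §2] -/
@[simp] theorem coe_upqImPart (M : Matrix (α ⊕ β) (α ⊕ β) ℂ) :
    ((upqImPart α β M : (uFormGroup α β).lie) : Matrix (α ⊕ β) (α ⊕ β) ℂ) = (2⁻¹ : ℂ) • (Complex.I • (upqTheta α β M - M)) := rfl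

/-- **`M = A(M) + i B(M)`.** [cite: Knapp2002, VI §2] -/
theorem coe_upqRePart_add_I_smul_coe_upqImPart (M : Matrix (α ⊕ β) (α ⊕ β) ℂ) :
    ((upqRePart α β M : (uFormGroup α β).lie) : Matrix (α ⊕ β) (α ⊕ β) ℂ) +
      Complex.I • ((upqImPart α β M : (uFormGroup α β).lie) : Matrix (α ⊕ β) (α ⊕ β) ℂ) = M := by
  rw [coe_upqRePart, coe_upqImPart]
  ext i j
  simp only [Matrix.add_apply, Matrix.smul_apply, Matrix.sub_apply, smul_eq_mul]
  ring_nf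
  rw [Complex.I_sq]
  ring

/-- `A` is additive. [cite: Knapp2002, VI §2] -/
theorem upqRePart_add (M N : Matrix (α ⊕ β) (α ⊕ β) ℂ) : upqRePart α β (M + N) = upqRePart α β M + upqRePart α β N := by
  apply Subtype.ext
  change (2⁻¹ : ℂ) • (M + N + upqTheta α β (M + N)) = (2⁻¹ : ℂ) • (M + upqTheta α β M) + (2⁻¹ : ℂ) • (N + upqTheta α β N)
  rw [upqTheta_add, ← smul_add]; congr 1; abel

/-- `B` is additive. [cite: Knapp2002, VI §2] -/
theorem upqImPart_add (M N : Matrix (α ⊕ β) (α ⊕ β) ℂ) : upqImPart α β (M + N) = upqImPart α β M + upqImPart α β N := by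
  apply Subtype.ext
  change (2⁻¹ : ℂ) • (Complex.I • (upqTheta α β (M + N) - (M + N))) =
    (2⁻¹ : ℂ) • (Complex.I • (upqTheta α β M - M)) + (2⁻¹ : ℂ) • (Complex.I • (upqTheta α β N - N))
  rw [upqTheta_add, ← smul_add, ← smul_add]; congr 2; abel

/-- Real scalars on `𝔲(α, β) ≤ 𝔤𝔩(α ⊕ β, ℂ)` act through `ℝ → ℂ` on the matrix. [folklore] -/
private theorem coe_real_smul (r : ℝ) (X : (uFormGroup α β).lie) :
    ((r • X : (uFormGroup α β).lie) : Matrix (α ⊕ β) (α ⊕ β) ℂ) = (r : ℂ) • (X : Matrix (α ⊕ β) (α ⊕ β) ℂ) := by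
  change r • (X : Matrix (α ⊕ β) (α ⊕ β) ℂ) = _
  rw [Complex.coe_smul]

/-- `A(c M) = (Re c) A(M) − (Im c) B(M)` (real scalars on `𝔲(α, β)`). [cite: Knapp2002, VI §2] -/
theorem upqRePart_smul (c : ℂ) (M : Matrix (α ⊕ β) (α ⊕ β) ℂ) :
    upqRePart α β (c • M) = c.re • upqRePart α β M - c.im • upqImPart α β M := by
  apply Subtype.ext
  rw [AddSubgroupClass.coe_sub, coe_real_smul, coe_real_smul, coe_upqRePart, coe_upqRePart, coe_upqImPart, upqTheta_smul]
  conv_lhs => rw [← Complex.re_add_im c]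
  rw [map_add, Complex.conj_ofReal, map_mul, Complex.conj_ofReal, Complex.conj_I]
  ext i j
  simp only [Matrix.smul_apply, Matrix.add_apply, Matrix.sub_apply, smul_eq_mul]
  ring

/-- `B(c M) = (Re c) B(M) + (Im c) A(M)`. [cite: Knapp2002, VI §2] -/
theorem upqImPart_smul (c : ℂ) (M : Matrix (α ⊕ β) (α ⊕ β) ℂ) :
    upqImPart α β (c • M) = c.re • upqImPart α β M + c.im • upqRePart α β M := by
  apply Subtype.ext
  rw [AddMemClass.coe_add, coe_real_smul, coe_real_smul, coe_upqRePart, coe_upqImPart, coe_upqImPart, upqTheta_smul]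
  conv_lhs => rw [← Complex.re_add_im c]
  rw [map_add, Complex.conj_ofReal, map_mul, Complex.conj_ofReal, Complex.conj_I]
  ext i j
  simp only [Matrix.smul_apply, Matrix.add_apply, Matrix.sub_apply, smul_eq_mul]
  linear_combination (-(2⁻¹ : ℂ) * (c.im : ℂ) * (upqTheta α β M i j + M i j)) * Complex.I_mul_I

/-- `A(X) = X` for `X ∈ 𝔲(α, β)`. [cite: Knapp2002, VI §2] -/
theorem upqRePart_coe (X : (uFormGroup α β).lie) : upqRePart α β (X : Matrix (α ⊕ β) (α ⊕ β) ℂ) = X := by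
  apply Subtype.ext
  rw [coe_upqRePart, upqTheta_of_mem, ← two_smul ℂ (X : Matrix (α ⊕ β) (α ⊕ β) ℂ), smul_smul]
  norm_num

/-- `B(X) = 0` for `X ∈ 𝔲(α, β)`. [cite: Knapp2002, VI §2] -/
theorem upqImPart_coe (X : (uFormGroup α β).lie) : upqImPart α β (X : Matrix (α ⊕ β) (α ⊕ β) ℂ) = 0 := by
  apply Subtype.ext
  rw [coe_upqImPart, upqTheta_of_mem, sub_self, smul_zero, smul_zero]
  rfl

/-- `A(θM) = A(M)`. [cite: Knapp2002, VI §2] -/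
theorem upqRePart_upqTheta (M : Matrix (α ⊕ β) (α ⊕ β) ℂ) : upqRePart α β (upqTheta α β M) = upqRePart α β M := by
  apply Subtype.ext
  rw [coe_upqRePart, coe_upqRePart, upqTheta_upqTheta, add_comm]

/-- `B(θM) = −B(M)`. [cite: Knapp2002, VI §2] -/
theorem upqImPart_upqTheta (M : Matrix (α ⊕ β) (α ⊕ β) ℂ) : upqImPart α β (upqTheta α β M) = -upqImPart α β M := by
  apply Subtype.ext
  rw [NegMemClass.coe_neg, coe_upqImPart, coe_upqImPart, upqTheta_upqTheta, ← smul_neg, ← smul_neg, neg_sub]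

/-- **`A[M, N] = [A M, A N] − [B M, B N]`** (since `θ[M, N] = [θM, θN]`). [cite: Knapp2002, VI §2] -/
theorem upqRePart_lie (M N : Matrix (α ⊕ β) (α ⊕ β) ℂ) :
    upqRePart α β ⁅M, N⁆ = ⁅upqRePart α β M, upqRePart α β N⁆ - ⁅upqImPart α β M, upqImPart α β N⁆ := by
  apply Subtype.ext
  rw [AddSubgroupClass.coe_sub, LieSubalgebra.coe_bracket, LieSubalgebra.coe_bracket, coe_upqRePart, coe_upqRePart, coe_upqRePart,
    coe_upqImPart, coe_upqImPart, upqTheta_lie, Ring.lie_def, Ring.lie_def, Ring.lie_def, Ring.lie_def]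
  set a := upqTheta α β M
  set b := upqTheta α β N
  have hI : (Complex.I * Complex.I) • (a * b) = (-1 : ℂ) • (a * b) := by rw [Complex.I_mul_I]
  have hI2 : (Complex.I * Complex.I) • (b * a) = (-1 : ℂ) • (b * a) := by rw [Complex.I_mul_I]
  have hI3 : (Complex.I * Complex.I) • (a * N) = (-1 : ℂ) • (a * N) := by rw [Complex.I_mul_I]
  have hI4 : (Complex.I * Complex.I) • (M * b) = (-1 : ℂ) • (M * b) := by rw [Complex.I_mul_I]
  have hI5 : (Complex.I * Complex.I) • (M * N) = (-1 : ℂ) • (M * N) := by rw [Complex.I_mul_I]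
  have hI6 : (Complex.I * Complex.I) • (b * M) = (-1 : ℂ) • (b * M) := by rw [Complex.I_mul_I]
  have hI7 : (Complex.I * Complex.I) • (N * a) = (-1 : ℂ) • (N * a) := by rw [Complex.I_mul_I]
  have hI8 : (Complex.I * Complex.I) • (N * M) = (-1 : ℂ) • (N * M) := by rw [Complex.I_mul_I]
  simp only [smul_add, smul_sub, mul_add, add_mul, mul_sub, sub_mul, smul_mul_assoc, mul_smul_comm, smul_smul]
  linear_combination (norm := module) ((2 : ℂ)⁻¹ * (2 : ℂ)⁻¹) • (hI - hI2 - hI3 - hI4 + hI5 + hI6 + hI7 - hI8)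

/-- **`B[M, N] = [A M, B N] + [B M, A N]`.** [cite: Knapp2002, VI §2] -/
theorem upqImPart_lie (M N : Matrix (α ⊕ β) (α ⊕ β) ℂ) :
    upqImPart α β ⁅M, N⁆ = ⁅upqRePart α β M, upqImPart α β N⁆ + ⁅upqImPart α β M, upqRePart α β N⁆ := by
  apply Subtype.ext
  rw [AddMemClass.coe_add, LieSubalgebra.coe_bracket, LieSubalgebra.coe_bracket, coe_upqImPart, coe_upqRePart, coe_upqRePart,
    coe_upqImPart, coe_upqImPart, upqTheta_lie, Ring.lie_def, Ring.lie_def, Ring.lie_def, Ring.lie_def]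
  set a := upqTheta α β M
  set b := upqTheta α β N
  simp only [smul_add, smul_sub, mul_add, add_mul, mul_sub, sub_mul, smul_mul_assoc, mul_smul_comm, smul_smul]
  module

end Parts

/-! ## §3 The complexified action `ρ_ℂ` -/

section LieC

variable {V : Type*} [AddCommGroup V] [Module ℂ V]
  (ρK : Representation ℂ (uFormGroup α β).maximalCompact V) (ρ𝔤 : (uFormGroup α β).lie →ₗ⁅ℝ⁆ Module.End ℂ V)

/-- Real scalars act on `End_ℂ(V)` through `ℝ → ℂ`. [folklore] -/
private theorem real_smul_end (t : ℝ) (f : Module.End ℂ V) : t • f = (t : ℂ) • f := by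
  ext v
  simp [LinearMap.smul_apply, Complex.coe_smul]

/-- The complexification identity in `End_ℂ(V)`: `[a + i b, a' + i b'] = ([a, a'] − [b, b']) + i ([a, b'] + [b, a'])`. [folklore] -/
private theorem lie_add_I_smul (a b a' b' : Module.End ℂ V) :
    ⁅a + Complex.I • b, a' + Complex.I • b'⁆ = (⁅a, a'⁆ - ⁅b, b'⁆) + Complex.I • (⁅a, b'⁆ + ⁅b, a'⁆) := by
  have h : (Complex.I * Complex.I) • ⁅b, b'⁆ = (-1 : ℂ) • ⁅b, b'⁆ := by rw [Complex.I_mul_I]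
  simp only [lie_add, add_lie, lie_smul, smul_lie, smul_add, smul_smul]
  linear_combination (norm := module) h

/-- **The complexified action `ρ_ℂ : 𝔤𝔩(α ⊕ β, ℂ) →ₗ⁅ℂ⁆ End_ℂ V`**, `ρ_ℂ(M) = ρ𝔤(A M) + i ρ𝔤(B M)` — `ℂ`-linear and a Lie algebra homomorphism
(`A[M,N] = [AM,AN] − [BM,BN]`, `B[M,N] = [AM,BN] + [BM,AN]`); it is THE complexification of the real action `ρ𝔤` of `𝔲(α, β)` (`upqLieC_coe`).
[cite: Knapp2002, VI §2] [cite: KnappVogan1995, §IV.1] -/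
def upqLieC : Matrix (α ⊕ β) (α ⊕ β) ℂ →ₗ⁅ℂ⁆ Module.End ℂ V :=
  { toFun := fun M => ρ𝔤 (upqRePart α β M) + Complex.I • ρ𝔤 (upqImPart α β M)
    map_add' := fun M N => by
      simp only [upqRePart_add, upqImPart_add, map_add, smul_add]
      abel
    map_smul' := fun c M => by
      rw [RingHom.id_apply, upqRePart_smul, upqImPart_smul, map_sub, map_add, map_smul, map_smul, map_smul, map_smul,
        real_smul_end, real_smul_end, real_smul_end, real_smul_end]
      set a := ρ𝔤 (upqRePart α β M)
      set b := ρ𝔤 (upqImPart α β M)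
      have h : (Complex.I * Complex.I) • b = (-1 : ℂ) • b := by rw [Complex.I_mul_I]
      conv_rhs => rw [← Complex.re_add_im c]
      simp only [smul_add, add_smul, smul_smul]
      linear_combination (norm := module) (-(c.im : ℂ)) • h
    map_lie' := fun {M N} => by
      simp only [upqRePart_lie, upqImPart_lie, map_sub, map_add, LieHom.map_lie]
      exact (lie_add_I_smul _ _ _ _).symm }

/-- Unfolding of `ρ_ℂ`. [cite: Knapp2002, VI §2] -/
theorem upqLieC_apply (M : Matrix (α ⊕ β) (α ⊕ β) ℂ) : upqLieC ρ𝔤 M = ρ𝔤 (upqRePart α β M) + Complex.I • ρ𝔤 (upqImPart α β M) := rfl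

/-- **`ρ_ℂ` extends `ρ𝔤`**: `ρ_ℂ(X) = ρ𝔤(X)` for `X ∈ 𝔲(α, β)`. [cite: Knapp2002, VI §2] -/
@[simp] theorem upqLieC_coe (X : (uFormGroup α β).lie) : upqLieC ρ𝔤 (X : Matrix (α ⊕ β) (α ⊕ β) ℂ) = ρ𝔤 X := by
  rw [upqLieC_apply, upqRePart_coe, upqImPart_coe, map_zero, smul_zero, add_zero]

/-- `ρ_ℂ` is a Lie homomorphism, commutator form: `ρ_ℂ(M N − N M) = ρ_ℂ M ρ_ℂ N − ρ_ℂ N ρ_ℂ M`. [cite: Knapp2002, VI §2] -/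
theorem upqLieC_mul_sub_mul (M N : Matrix (α ⊕ β) (α ⊕ β) ℂ) :
    upqLieC ρ𝔤 (M * N - N * M) = upqLieC ρ𝔤 M * upqLieC ρ𝔤 N - upqLieC ρ𝔤 N * upqLieC ρ𝔤 M := by
  rw [← Ring.lie_def, LieHom.map_lie, Ring.lie_def]

/-- Commuting matrices act by commuting operators. [cite: Knapp2002, VI §2] -/
theorem upqLieC_comm_of_comm {M N : Matrix (α ⊕ β) (α ⊕ β) ℂ} (h : M * N = N * M) :
    upqLieC ρ𝔤 M * upqLieC ρ𝔤 N = upqLieC ρ𝔤 N * upqLieC ρ𝔤 M := by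
  have := upqLieC_mul_sub_mul ρ𝔤 M N
  rw [h, sub_self, map_zero] at this
  exact (sub_eq_zero.mp this.symm)

/-- **`ρ_ℂ` of a block-diagonal matrix preserves every `𝔨`-stable complex subspace** (its real and imaginary parts are block diagonal, i.e. in `𝔨`).
[cite: BorelWallach2000, II §1.1 (3)] [cite: Knapp2002, VI §2] -/
theorem upqLieC_fromBlocks_diag_apply_mem (D₁ : Matrix α α ℂ) (D₂ : Matrix β β ℂ) {U : Submodule ℂ V}
    (hU : ∀ Y ∈ (uFormGroup α β).kInLie, ∀ u ∈ U, ρ𝔤 Y u ∈ U) {u : V} (hu : u ∈ U) :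
    upqLieC ρ𝔤 (Matrix.fromBlocks D₁ 0 0 D₂) u ∈ U := by
  have hθ : upqTheta α β (Matrix.fromBlocks D₁ 0 0 D₂) = Matrix.fromBlocks (-D₁ᴴ) 0 0 (-D₂ᴴ) := by
    rw [upqTheta, Matrix.fromBlocks_conjTranspose, signForm, Matrix.fromBlocks_multiply, Matrix.fromBlocks_multiply]
    simp [Matrix.fromBlocks_neg]
  have hA : upqRePart α β (Matrix.fromBlocks D₁ 0 0 D₂) ∈ (uFormGroup α β).kInLie := by
    rw [upq_mem_kInLie_iff_blocks, coe_upqRePart, hθ, Matrix.fromBlocks_add, Matrix.fromBlocks_smul, Matrix.toBlocks_fromBlocks₁₂, add_zero, smul_zero]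
  have hB : upqImPart α β (Matrix.fromBlocks D₁ 0 0 D₂) ∈ (uFormGroup α β).kInLie := by
    rw [upq_mem_kInLie_iff_blocks, coe_upqImPart, hθ, sub_eq_add_neg, Matrix.fromBlocks_neg, Matrix.fromBlocks_add, Matrix.fromBlocks_smul,
      Matrix.fromBlocks_smul, Matrix.toBlocks_fromBlocks₁₂, neg_zero, add_zero, smul_zero, smul_zero]
  rw [upqLieC_apply, LinearMap.add_apply, LinearMap.smul_apply]
  exact U.add_mem (hU _ hA u hu) (U.smul_mem _ (hU _ hB u hu))

/-! ### `K`-conjugation -/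

/-- `θ` commutes with conjugation by `k ∈ K = U(α) × U(β)` (`k` unitary and `k D = D k`): `θ(k M k⁻¹) = k θ(M) k⁻¹`. [cite: Knapp2002, VI §2] -/
theorem upqTheta_conj (k : (uFormGroup α β).maximalCompact) (M : Matrix (α ⊕ β) (α ⊕ β) ℂ) :
    upqTheta α β (((k : GL (α ⊕ β) ℂ) : Matrix (α ⊕ β) (α ⊕ β) ℂ) * M * (((k : GL (α ⊕ β) ℂ)⁻¹ : GL (α ⊕ β) ℂ) : Matrix (α ⊕ β) (α ⊕ β) ℂ)) =
      ((k : GL (α ⊕ β) ℂ) : Matrix (α ⊕ β) (α ⊕ β) ℂ) * upqTheta α β M * (((k : GL (α ⊕ β) ℂ)⁻¹ : GL (α ⊕ β) ℂ) : Matrix (α ⊕ β) (α ⊕ β) ℂ) := by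
  set m : Matrix (α ⊕ β) (α ⊕ β) ℂ := ((k : GL (α ⊕ β) ℂ) : Matrix (α ⊕ β) (α ⊕ β) ℂ) with hm
  have hk := (RealMatrixGroup.mem_maximalCompact_iff (uFormGroup α β) (k : GL (α ⊕ β) ℂ)).1 k.2
  have hU : mᴴ * signForm α β * m = signForm α β := (mem_uFormGroup_carrier_iff _).1 hk.1
  have hunit : mᴴ * m = 1 := by rw [← Matrix.star_eq_conjTranspose]; exact hk.2
  have hunit' : m * mᴴ = 1 := mul_eq_one_comm.1 hunit
  have hinv : (((k : GL (α ⊕ β) ℂ)⁻¹ : GL (α ⊕ β) ℂ) : Matrix (α ⊕ β) (α ⊕ β) ℂ) = mᴴ := by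
    rw [Matrix.coe_units_inv]
    exact Matrix.inv_eq_left_inv hunit
  have hSm : signForm α β * m = m * signForm α β := by
    calc signForm α β * m = m * mᴴ * signForm α β * m := by rw [hunit', Matrix.one_mul]
      _ = m * (mᴴ * signForm α β * m) := by simp only [Matrix.mul_assoc]
      _ = m * signForm α β := by rw [hU]
  have hSm' : signForm α β * mᴴ = mᴴ * signForm α β := by
    have := congrArg Matrix.conjTranspose hSm
    rwa [Matrix.conjTranspose_mul, Matrix.conjTranspose_mul, conjTranspose_signForm, eq_comm] at this
  rw [hinv, upqTheta, upqTheta, Matrix.conjTranspose_mul, Matrix.conjTranspose_mul, Matrix.conjTranspose_conjTranspose, Matrix.mul_neg,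
    Matrix.neg_mul]
  congr 1
  calc signForm α β * (m * (Mᴴ * mᴴ)) * signForm α β
        = (signForm α β * m) * Mᴴ * (mᴴ * signForm α β) := by simp only [Matrix.mul_assoc]
    _ = (m * signForm α β) * Mᴴ * (signForm α β * mᴴ) := by rw [hSm, hSm']
    _ = m * (signForm α β * Mᴴ * signForm α β) * mᴴ := by simp only [Matrix.mul_assoc]

/-- `A(k M k⁻¹) = Ad k (A M)` for `k ∈ K`. [cite: Knapp2002, VI §2] -/
theorem upqRePart_conj (k : (uFormGroup α β).maximalCompact) (M : Matrix (α ⊕ β) (α ⊕ β) ℂ) :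
    upqRePart α β (((k : GL (α ⊕ β) ℂ) : Matrix (α ⊕ β) (α ⊕ β) ℂ) * M * (((k : GL (α ⊕ β) ℂ)⁻¹ : GL (α ⊕ β) ℂ) : Matrix (α ⊕ β) (α ⊕ β) ℂ)) =
      (uFormGroup α β).Ad (Subgroup.inclusion (uFormGroup α β).maximalCompact_le_carrier k) (upqRePart α β M) := by
  apply Subtype.ext
  rw [RealMatrixGroup.Ad_apply_coe, coe_upqRePart, coe_upqRePart, upqTheta_conj, Matrix.mul_smul, Matrix.smul_mul, Matrix.mul_add,
    Matrix.add_mul]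
  rfl

/-- `B(k M k⁻¹) = Ad k (B M)` for `k ∈ K`. [cite: Knapp2002, VI §2] -/
theorem upqImPart_conj (k : (uFormGroup α β).maximalCompact) (M : Matrix (α ⊕ β) (α ⊕ β) ℂ) :
    upqImPart α β (((k : GL (α ⊕ β) ℂ) : Matrix (α ⊕ β) (α ⊕ β) ℂ) * M * (((k : GL (α ⊕ β) ℂ)⁻¹ : GL (α ⊕ β) ℂ) : Matrix (α ⊕ β) (α ⊕ β) ℂ)) =
      (uFormGroup α β).Ad (Subgroup.inclusion (uFormGroup α β).maximalCompact_le_carrier k) (upqImPart α β M) := by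
  apply Subtype.ext
  rw [RealMatrixGroup.Ad_apply_coe, coe_upqImPart, coe_upqImPart, upqTheta_conj, Matrix.mul_smul, Matrix.smul_mul, Matrix.mul_smul,
    Matrix.smul_mul, Matrix.mul_sub, Matrix.sub_mul]
  rfl

/-- **`K`-CONJUGATION**: `ρK(k) ρ_ℂ(M) ρK(k)⁻¹ = ρ_ℂ(k M k⁻¹)` (★ `IsGKModule.ad_compat` on the real and imaginary parts).
[cite: KnappVogan1995, §IV.1] [cite: Knapp2002, VI §2] -/
theorem ρK_comp_upqLieC_comp_ρK_inv (hV : IsGKModule (uFormGroup α β) ρK ρ𝔤) (k : (uFormGroup α β).maximalCompact)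
    (M : Matrix (α ⊕ β) (α ⊕ β) ℂ) :
    ρK k ∘ₗ upqLieC ρ𝔤 M ∘ₗ ρK k⁻¹ =
      upqLieC ρ𝔤 (((k : GL (α ⊕ β) ℂ) : Matrix (α ⊕ β) (α ⊕ β) ℂ) * M * (((k : GL (α ⊕ β) ℂ)⁻¹ : GL (α ⊕ β) ℂ) : Matrix (α ⊕ β) (α ⊕ β) ℂ)) := by
  rw [upqLieC_apply, upqLieC_apply, upqRePart_conj, upqImPart_conj, ← hV.ad_compat, ← hV.ad_compat, LinearMap.add_comp, LinearMap.smul_comp,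
    LinearMap.comp_add, LinearMap.comp_smul]

/-- `K`-conjugation applied to a vector: `ρK(k) (ρ_ℂ(M) v) = ρ_ℂ(k M k⁻¹) (ρK(k) v)`. [cite: KnappVogan1995, §IV.1] -/
theorem ρK_upqLieC_apply (hV : IsGKModule (uFormGroup α β) ρK ρ𝔤) (k : (uFormGroup α β).maximalCompact)
    (M : Matrix (α ⊕ β) (α ⊕ β) ℂ) (v : V) :
    ρK k (upqLieC ρ𝔤 M v) =
      upqLieC ρ𝔤 (((k : GL (α ⊕ β) ℂ) : Matrix (α ⊕ β) (α ⊕ β) ℂ) * M * (((k : GL (α ⊕ β) ℂ)⁻¹ : GL (α ⊕ β) ℂ) : Matrix (α ⊕ β) (α ⊕ β) ℂ))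
        (ρK k v) := by
  have h := LinearMap.congr_fun (ρK_comp_upqLieC_comp_ρK_inv ρK ρ𝔤 hV k M) (ρK k v)
  simp only [LinearMap.coe_comp, Function.comp_apply] at h
  rw [← Module.End.mul_apply (ρK k⁻¹), ← map_mul, inv_mul_cancel, map_one, Module.End.one_apply] at h
  exact h

end LieC

/-! ## §4 The root operators `E_B = ρ_ℂ [[0,B],[0,0]]`, `F_C = ρ_ℂ [[0,0],[C,0]]` -/

section Roots

variable {V : Type*} [AddCommGroup V] [Module ℂ V]
  (ρK : Representation ℂ (uFormGroup α β).maximalCompact V) (ρ𝔤 : (uFormGroup α β).lie →ₗ⁅ℝ⁆ Module.End ℂ V)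

/-- **`E_B := ρ_ℂ [[0, B], [0, 0]]`** (`B ∈ M_{α×β}(ℂ)`), the action of `𝔭⁺`, `ℂ`-linear in `B`. [cite: BorelWallach2000, II §4.1–4.2] -/
def upqEOp : Matrix α β ℂ →ₗ[ℂ] Module.End ℂ V :=
  (upqLieC ρ𝔤 : Matrix (α ⊕ β) (α ⊕ β) ℂ →ₗ[ℂ] Module.End ℂ V) ∘ₗ
    { toFun := fun B => Matrix.fromBlocks 0 B 0 0
      map_add' := fun B B' => by rw [Matrix.fromBlocks_add]; simp
      map_smul' := fun c B => by rw [Matrix.fromBlocks_smul]; simp }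

/-- **`F_C := ρ_ℂ [[0, 0], [C, 0]]`** (`C ∈ M_{β×α}(ℂ)`), the action of `𝔭⁻`, `ℂ`-linear in `C`. [cite: BorelWallach2000, II §4.1–4.2] -/
def upqFOp : Matrix β α ℂ →ₗ[ℂ] Module.End ℂ V :=
  (upqLieC ρ𝔤 : Matrix (α ⊕ β) (α ⊕ β) ℂ →ₗ[ℂ] Module.End ℂ V) ∘ₗ
    { toFun := fun C => Matrix.fromBlocks 0 0 C 0
      map_add' := fun C C' => by rw [Matrix.fromBlocks_add]; simp
      map_smul' := fun c C => by rw [Matrix.fromBlocks_smul]; simp }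

/-- Unfolding of `E_B`. [cite: BorelWallach2000, II §4.1] -/
theorem upqEOp_apply (B : Matrix α β ℂ) : upqEOp ρ𝔤 B = upqLieC ρ𝔤 (Matrix.fromBlocks 0 B 0 0) := rfl

/-- Unfolding of `F_C`. [cite: BorelWallach2000, II §4.1] -/
theorem upqFOp_apply (C : Matrix β α ℂ) : upqFOp ρ𝔤 C = upqLieC ρ𝔤 (Matrix.fromBlocks 0 0 C 0) := rfl

/-- **`ρ𝔤(X_B) = E_B + F_{Bᴴ}`** for the hermitian generator `X_B = [[0, B], [Bᴴ, 0]] ∈ 𝔭`. [cite: BorelWallach2000, II §1.1 (3), §4.1] -/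
theorem ρ𝔤_offDiag_eq (B : Matrix α β ℂ) :
    ρ𝔤 ⟨Matrix.fromBlocks 0 B Bᴴ 0, upq_offDiag_mem_lie B⟩ = upqEOp ρ𝔤 B + upqFOp ρ𝔤 Bᴴ := by
  rw [upqEOp_apply, upqFOp_apply, ← map_add, Matrix.fromBlocks_add, add_zero, zero_add, add_zero, zero_add,
    ← upqLieC_coe ρ𝔤 ⟨Matrix.fromBlocks 0 B Bᴴ 0, upq_offDiag_mem_lie B⟩]

/-- **`ρ𝔤(X_{cE_p}) = c E_p + c̄ F_p`** with `E_p := E_{E_{ab}}`, `F_p := F_{E_{ba}}` (`p = (a, b)`). [cite: BorelWallach2000, II §1.1 (5), §4.1] -/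
theorem ρ𝔤_upqUnit_eq (p : α × β) (c : ℂ) :
    ρ𝔤 (upqUnit p c) = c • upqEOp ρ𝔤 (Matrix.single p.1 p.2 1) + conj c • upqFOp ρ𝔤 (Matrix.single p.2 p.1 1) := by
  have h : (upqUnit p c : (uFormGroup α β).lie) = ⟨Matrix.fromBlocks 0 (Matrix.single p.1 p.2 c) (Matrix.single p.1 p.2 c)ᴴ 0,
      upq_offDiag_mem_lie _⟩ := Subtype.ext rfl
  rw [h, ρ𝔤_offDiag_eq, Matrix.conjTranspose_single, Complex.star_def, ← map_smul, ← map_smul, Matrix.smul_single, Matrix.smul_single,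
    smul_eq_mul, mul_one, smul_eq_mul, mul_one]

/-- **`𝔭⁺` is abelian: `E_B E_{B'} = E_{B'} E_B`.** [cite: BorelWallach2000, II §4.2] -/
theorem upqEOp_comm (B B' : Matrix α β ℂ) : upqEOp ρ𝔤 B * upqEOp ρ𝔤 B' = upqEOp ρ𝔤 B' * upqEOp ρ𝔤 B :=
  upqLieC_comm_of_comm ρ𝔤 (by simp [Matrix.fromBlocks_multiply])

/-- **`𝔭⁻` is abelian: `F_C F_{C'} = F_{C'} F_C`.** [cite: BorelWallach2000, II §4.2] -/
theorem upqFOp_comm (C C' : Matrix β α ℂ) : upqFOp ρ𝔤 C * upqFOp ρ𝔤 C' = upqFOp ρ𝔤 C' * upqFOp ρ𝔤 C :=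
  upqLieC_comm_of_comm ρ𝔤 (by simp [Matrix.fromBlocks_multiply])

/-- **`[𝔭⁺, 𝔭⁻] ⊆ 𝔨_ℂ`: `E_B F_C − F_C E_B = ρ_ℂ [[B C, 0], [0, −C B]]`.** [cite: BorelWallach2000, II §1.1 (4), §4.2] -/
theorem upqEOp_mul_upqFOp_sub (B : Matrix α β ℂ) (C : Matrix β α ℂ) :
    upqEOp ρ𝔤 B * upqFOp ρ𝔤 C - upqFOp ρ𝔤 C * upqEOp ρ𝔤 B = upqLieC ρ𝔤 (Matrix.fromBlocks (B * C) 0 0 (-(C * B))) := by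
  rw [upqEOp_apply, upqFOp_apply, ← upqLieC_mul_sub_mul]
  congr 1
  simp [Matrix.fromBlocks_multiply, sub_eq_add_neg, Matrix.fromBlocks_neg, Matrix.fromBlocks_add]

/-- In particular `[E_B, F_C]` preserves every `𝔨`-stable complex subspace. [cite: BorelWallach2000, II §1.1 (4)] -/
theorem upqEOp_mul_upqFOp_sub_apply_mem (B : Matrix α β ℂ) (C : Matrix β α ℂ) {U : Submodule ℂ V}
    (hU : ∀ Y ∈ (uFormGroup α β).kInLie, ∀ u ∈ U, ρ𝔤 Y u ∈ U) {u : V} (hu : u ∈ U) :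
    (upqEOp ρ𝔤 B * upqFOp ρ𝔤 C - upqFOp ρ𝔤 C * upqEOp ρ𝔤 B) u ∈ U := by
  rw [upqEOp_mul_upqFOp_sub]
  exact upqLieC_fromBlocks_diag_apply_mem ρ𝔤 _ _ hU hu

/-- **`ad(𝔨_ℂ)` on `𝔭⁺`**: `ρ_ℂ [[D₁,0],[0,D₂]] E_B − E_B ρ_ℂ [[D₁,0],[0,D₂]] = E_{D₁ B − B D₂}`. [cite: BorelWallach2000, II §4.1] -/
theorem upqLieC_diag_mul_upqEOp_sub (D₁ : Matrix α α ℂ) (D₂ : Matrix β β ℂ) (B : Matrix α β ℂ) :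
    upqLieC ρ𝔤 (Matrix.fromBlocks D₁ 0 0 D₂) * upqEOp ρ𝔤 B - upqEOp ρ𝔤 B * upqLieC ρ𝔤 (Matrix.fromBlocks D₁ 0 0 D₂) =
      upqEOp ρ𝔤 (D₁ * B - B * D₂) := by
  rw [upqEOp_apply, upqEOp_apply, ← upqLieC_mul_sub_mul]
  congr 1
  simp [Matrix.fromBlocks_multiply, sub_eq_add_neg, Matrix.fromBlocks_neg, Matrix.fromBlocks_add]

/-- **`ad(𝔨_ℂ)` on `𝔭⁻`**: `ρ_ℂ [[D₁,0],[0,D₂]] F_C − F_C ρ_ℂ [[D₁,0],[0,D₂]] = F_{D₂ C − C D₁}`. [cite: BorelWallach2000, II §4.1] -/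
theorem upqLieC_diag_mul_upqFOp_sub (D₁ : Matrix α α ℂ) (D₂ : Matrix β β ℂ) (C : Matrix β α ℂ) :
    upqLieC ρ𝔤 (Matrix.fromBlocks D₁ 0 0 D₂) * upqFOp ρ𝔤 C - upqFOp ρ𝔤 C * upqLieC ρ𝔤 (Matrix.fromBlocks D₁ 0 0 D₂) =
      upqFOp ρ𝔤 (D₂ * C - C * D₁) := by
  rw [upqFOp_apply, upqFOp_apply, ← upqLieC_mul_sub_mul]
  congr 1
  simp [Matrix.fromBlocks_multiply, sub_eq_add_neg, Matrix.fromBlocks_neg, Matrix.fromBlocks_add]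

/-- `ρ𝔤(z₀) = ρ_ℂ [[i·1, 0], [0, 0]]` (★ `upqZ0`). [cite: BorelWallach2000, II §4.1] -/
theorem ρ𝔤_upqZ0_eq : ρ𝔤 (upqZ0 α β) = upqLieC ρ𝔤 (Matrix.fromBlocks (Complex.I • (1 : Matrix α α ℂ)) 0 0 0) := by
  rw [← upqLieC_coe ρ𝔤 (upqZ0 α β), coe_upqZ0]

/-- **The `ℤ`-grading by `z₀` on `𝔭⁺`: `ρ𝔤(z₀) E_B − E_B ρ𝔤(z₀) = i E_B`.** [cite: BorelWallach2000, II §4.1] -/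
theorem ρ𝔤_upqZ0_mul_upqEOp_sub (B : Matrix α β ℂ) :
    ρ𝔤 (upqZ0 α β) * upqEOp ρ𝔤 B - upqEOp ρ𝔤 B * ρ𝔤 (upqZ0 α β) = Complex.I • upqEOp ρ𝔤 B := by
  rw [ρ𝔤_upqZ0_eq, upqLieC_diag_mul_upqEOp_sub, ← map_smul, Matrix.smul_mul, Matrix.one_mul, Matrix.mul_zero, sub_zero]

/-- **The `ℤ`-grading by `z₀` on `𝔭⁻`: `ρ𝔤(z₀) F_C − F_C ρ𝔤(z₀) = −i F_C`.** [cite: BorelWallach2000, II §4.1] -/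
theorem ρ𝔤_upqZ0_mul_upqFOp_sub (C : Matrix β α ℂ) :
    ρ𝔤 (upqZ0 α β) * upqFOp ρ𝔤 C - upqFOp ρ𝔤 C * ρ𝔤 (upqZ0 α β) = -(Complex.I • upqFOp ρ𝔤 C) := by
  rw [ρ𝔤_upqZ0_eq, upqLieC_diag_mul_upqFOp_sub, Matrix.zero_mul, Matrix.mul_smul, Matrix.mul_one, zero_sub, map_neg, map_smul]

/-- **`K`-conjugation of `E_B`**: `ρK(k) E_B v = E_{k₁ B k₂ᴴ} (ρK(k) v)` for `k = diag(k₁, k₂) ∈ K = U(α) × U(β)`.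
[cite: BorelWallach2000, VI 4.8 (3)] [cite: KnappVogan1995, §IV.1] -/
theorem ρK_upqEOp_apply (hV : IsGKModule (uFormGroup α β) ρK ρ𝔤) (k : (uFormGroup α β).maximalCompact) (B : Matrix α β ℂ) (v : V) :
    ρK k (upqEOp ρ𝔤 B v) =
      upqEOp ρ𝔤 (((upqKBlock₁ k : Matrix.unitaryGroup α ℂ) : Matrix α α ℂ) * B * (((upqKBlock₂ k : Matrix.unitaryGroup β ℂ) : Matrix β β ℂ))ᴴ)
        (ρK k v) := by
  rw [upqEOp_apply, upqEOp_apply, ρK_upqLieC_apply ρK ρ𝔤 hV]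
  congr 2
  obtain ⟨h12, h21, -, h11', h22, -⟩ := upq_K_blocks k
  set m : Matrix (α ⊕ β) (α ⊕ β) ℂ := ((k : GL (α ⊕ β) ℂ) : Matrix (α ⊕ β) (α ⊕ β) ℂ) with hm
  have hk := (RealMatrixGroup.mem_maximalCompact_iff (uFormGroup α β) (k : GL (α ⊕ β) ℂ)).1 k.2
  have hunit : mᴴ * m = 1 := by rw [← Matrix.star_eq_conjTranspose]; exact hk.2
  have hinv : (((k : GL (α ⊕ β) ℂ)⁻¹ : GL (α ⊕ β) ℂ) : Matrix (α ⊕ β) (α ⊕ β) ℂ) = mᴴ := by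
    rw [Matrix.coe_units_inv]; exact Matrix.inv_eq_left_inv hunit
  rw [hinv]
  conv_lhs => rw [← Matrix.fromBlocks_toBlocks m, h12, h21]
  rw [Matrix.fromBlocks_conjTranspose, Matrix.fromBlocks_multiply, Matrix.fromBlocks_multiply]
  simp [coe_upqKBlock₁, coe_upqKBlock₂, hm]

/-- **`K`-conjugation of `F_C`**: `ρK(k) F_C v = F_{k₂ C k₁ᴴ} (ρK(k) v)` for `k = diag(k₁, k₂) ∈ K`. [cite: BorelWallach2000, VI 4.8 (3)] -/
theorem ρK_upqFOp_apply (hV : IsGKModule (uFormGroup α β) ρK ρ𝔤) (k : (uFormGroup α β).maximalCompact) (C : Matrix β α ℂ) (v : V) :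
    ρK k (upqFOp ρ𝔤 C v) =
      upqFOp ρ𝔤 (((upqKBlock₂ k : Matrix.unitaryGroup β ℂ) : Matrix β β ℂ) * C * (((upqKBlock₁ k : Matrix.unitaryGroup α ℂ) : Matrix α α ℂ))ᴴ)
        (ρK k v) := by
  rw [upqFOp_apply, upqFOp_apply, ρK_upqLieC_apply ρK ρ𝔤 hV]
  congr 2
  obtain ⟨h12, h21, -, -, -, -⟩ := upq_K_blocks k
  set m : Matrix (α ⊕ β) (α ⊕ β) ℂ := ((k : GL (α ⊕ β) ℂ) : Matrix (α ⊕ β) (α ⊕ β) ℂ) with hm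
  have hk := (RealMatrixGroup.mem_maximalCompact_iff (uFormGroup α β) (k : GL (α ⊕ β) ℂ)).1 k.2
  have hunit : mᴴ * m = 1 := by rw [← Matrix.star_eq_conjTranspose]; exact hk.2
  have hinv : (((k : GL (α ⊕ β) ℂ)⁻¹ : GL (α ⊕ β) ℂ) : Matrix (α ⊕ β) (α ⊕ β) ℂ) = mᴴ := by
    rw [Matrix.coe_units_inv]; exact Matrix.inv_eq_left_inv hunit
  rw [hinv]
  conv_lhs => rw [← Matrix.fromBlocks_toBlocks m, h12, h21]
  rw [Matrix.fromBlocks_conjTranspose, Matrix.fromBlocks_multiply, Matrix.fromBlocks_multiply]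
  simp [coe_upqKBlock₁, coe_upqKBlock₂, hm]

/-- Consequently **`E(U) := Σ_B E_B U` of a `K`-stable subspace is `K`-stable**: `ρK(k) (E_B u) ∈ ⨆_{B'} E_{B'} U`.
[cite: BorelWallach2000, VI 4.8 (3)] -/
theorem ρK_upqEOp_apply_mem_iSup (hV : IsGKModule (uFormGroup α β) ρK ρ𝔤) {U : Submodule ℂ V}
    (hU : ∀ (k : (uFormGroup α β).maximalCompact), ∀ u ∈ U, ρK k u ∈ U) (k : (uFormGroup α β).maximalCompact) (B : Matrix α β ℂ)
    {u : V} (hu : u ∈ U) : ρK k (upqEOp ρ𝔤 B u) ∈ ⨆ B' : Matrix α β ℂ, U.map (upqEOp ρ𝔤 B') := by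
  rw [ρK_upqEOp_apply ρK ρ𝔤 hV]
  exact Submodule.mem_iSup_of_mem _ (Submodule.mem_map_of_mem (hU k u hu))

/-- And **`F(U) := Σ_C F_C U` of a `K`-stable subspace is `K`-stable.** [cite: BorelWallach2000, VI 4.8 (3)] -/
theorem ρK_upqFOp_apply_mem_iSup (hV : IsGKModule (uFormGroup α β) ρK ρ𝔤) {U : Submodule ℂ V}
    (hU : ∀ (k : (uFormGroup α β).maximalCompact), ∀ u ∈ U, ρK k u ∈ U) (k : (uFormGroup α β).maximalCompact) (C : Matrix β α ℂ)
    {u : V} (hu : u ∈ U) : ρK k (upqFOp ρ𝔤 C u) ∈ ⨆ C' : Matrix β α ℂ, U.map (upqFOp ρ𝔤 C') := by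
  rw [ρK_upqFOp_apply ρK ρ𝔤 hV]
  exact Submodule.mem_iSup_of_mem _ (Submodule.mem_map_of_mem (hU k u hu))

end Roots

end Literature.NumberTheory.Automorphic

end
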